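import Literature.NumberTheory.Sieve.FGKMT2018MultidimensionalSieve
import HarnessLib

/-!
# FGKMT 2018 §8 / Maynard 2016 §7 — structure lemmas for the typed sieve weights

Support file for the edge «Theorem 6 ⟹ Theorem 5» of Ford–Green–Konyagin–Maynard–Tao,
*Long gaps between primes*, §8: purely algebraic / combinatorial facts about the objects typed in
`FGKMT2018MultidimensionalSieve.lean` (`omegaL`, `dkBox`, `singFactor`, `singPartial`,
`singSeriesExcl`, `phiOmega`, `yVar`, `lamVar`, `sieveWt`), used in §8 to compare the weights of
the families `𝓛_p = {n + h_i p}` and their translates: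

* residue-class form of `ω_𝓛(p)` (`omegaL_eq_card_zmod`) and of admissibility
  (`formsAdmissible_iff_omegaL`: admissible iff `ω(s) < s` for all primes `s`);
* TRANSLATION INVARIANCE (§8, the (wap)/(wcp) steps "by translation"): for `shiftForms L c`
  (`(a, b) ↦ (a, b − a c)`), every object is unchanged and `w_{𝓛'}(n + c) = w_𝓛(n)`
  (`sieveWt_shiftForms`);
* the local counts of `𝓛_p = tupleForms h p`: `ω(s) = ν_h(s)` for primes `s ∤ p`, `ω(p) = 1`
  (`omegaL_tupleForms`, `omegaL_tupleForms_self`), admissibility (`formsAdmissible_tupleForms`);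
* §8 "the set 𝒟_k(𝓛_p) … is independent of p": for `p > R` prime, `dkBox (𝓛_p) B R` is the set of
  `d` in the box with `∏ d` squarefree and coprime to `W B` (`dkBox_tupleForms`, `dkBoxCoprime`),
  and `φ_ω` agrees with that of `𝓛_1` on the support (`phiOmega_tupleForms_of_mem`);
* the singular-series partial products of `𝓛_p` and `𝓛_1 = {n + h_i}` differ exactly in the
  factor at `p` (`singPartial_tupleForms_mul`), the source of §8's `𝔖(𝓛_p) = (1 + O(k/x)) 𝔖`;
* the family `L̃_{q,i₀} = wbpForms h q i₀` of the proof of (6.4): values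
  (`formEval_wbpForms_eq`: `L̃_j(p) = L_j(q − h_{i₀} p)` for `j ≠ i₀`), local counts
  `ω(s) = ν_h(s)` for primes `s ∤ q` via the bijection `x ↦ h_{i₀} − q x⁻¹` (`omegaL_wbpForms`),
  `ω(q) = 1`, admissibility, `𝒟_k(L̃_{q,i₀}) =` the `p`-free box (`dkBox_wbpForms`), `φ_ω` and
  partial products vs `𝓛_1` (`phiOmega_wbpForms`, `singPartial_wbpForms_mul`);
* COMPARISON PRINCIPLE (§8 proof of (6.4): "`w(p, q − h_i p) = (1 + O(k/x)) w̃`"): two families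
  with the same `𝒟_k`, the same `φ_ω` on the support, equivalent cut-off conditions and the same
  admissible divisors have `λ_d 𝔖'_{WB} = λ'_d 𝔖_{WB}` and `w 𝔖'² = w' 𝔖²`
  (`lamVar_mul_singSeriesExcl`, `sieveWt_mul_sq_singSeriesExcl`).

Everything here is elementary (finite bijections in `ZMod s`, `Finset` algebra); no estimate of
§8 is proved in this file.

## References
* K. Ford, B. Green, S. Konyagin, J. Maynard, T. Tao, *Long gaps between primes*, J. Amer. Math.
  Soc. 31 (2018), §8 (arXiv:1412.5029v4 pp. 22–24).
* J. Maynard, *Dense clusters of primes in subsets*, Compositio Math. 152 (2016), §7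
  (arXiv:1405.2593 pp. 13–14).
-/

open Finset Filter

namespace Literature.NumberTheory.Sieve.FGKMT2018

variable {k : ℕ}

/-! ### Residue-class form of the forms and of `ω` -/

/-- The form `l = (a, b)` reduced mod `p`, as a function on `ZMod p`: `a·x + b`.
[cite: Maynard2016DenseClusters, §7 (7.1)] -/
def formMod (l : ℤ × ℤ) (p : ℕ) (x : ZMod p) : ZMod p :=
  ((l.1 : ℤ) : ZMod p) * x + ((l.2 : ℤ) : ZMod p)

/-- `L(n) mod p = formMod l p n`. [cite: Maynard2016DenseClusters, §7] -/
theorem intCast_formEval (l : ℤ × ℤ) (p : ℕ) (n : ℤ) :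
    ((formEval l n : ℤ) : ZMod p) = formMod l p n := by
  simp only [formEval, formMod, Int.cast_add, Int.cast_mul]

/-- `p ∣ L(n)` iff `formMod l p n = 0`. [cite: Maynard2016DenseClusters, §7] -/
theorem natCast_dvd_formEval_iff (l : ℤ × ℤ) (p : ℕ) [NeZero p] (n : ℤ) :
    (p : ℤ) ∣ formEval l n ↔ formMod l p n = 0 := by
  rw [← ZMod.intCast_zmod_eq_zero_iff_dvd, intCast_formEval]

/-- `p ∣ ∏ᵢ Lᵢ(n)` iff `∏ᵢ formMod Lᵢ p n = 0`. [cite: Maynard2016DenseClusters, §7] -/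
theorem natCast_dvd_prod_formEval_iff (L : Fin k → ℤ × ℤ) (p : ℕ) [NeZero p] (n : ℤ) :
    (p : ℤ) ∣ ∏ i, formEval (L i) n ↔ ∏ i, formMod (L i) p n = 0 := by
  rw [← ZMod.intCast_zmod_eq_zero_iff_dvd, Int.cast_prod]
  simp only [intCast_formEval]

/-- A witness `n < p` exists iff a residue class exists (the passage between Maynard's
`1 ≤ n ≤ p` and `ℤ/pℤ` in (7.1)). [cite: Maynard2016DenseClusters, §7 (7.1)] -/
theorem exists_range_iff_exists_zmod {p : ℕ} [NeZero p] (P : ZMod p → Prop) :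
    (∃ n ∈ Finset.range p, P (n : ZMod p)) ↔ ∃ x : ZMod p, P x := by
  refine ⟨fun ⟨n, _, hn⟩ => ⟨_, hn⟩, fun ⟨x, hx⟩ => ⟨x.val, Finset.mem_range.mpr (ZMod.val_lt x), ?_⟩⟩
  simpa only [ZMod.natCast_zmod_val] using hx

/-- **`ω_𝓛(p)` counts residue classes**: for `p ≥ 1`,
`ω_𝓛(p) = #{x ∈ ℤ/pℤ : ∏ᵢ (aᵢ x + bᵢ) = 0}`. [cite: Maynard2016DenseClusters, §7 (7.1)] -/
theorem omegaL_eq_card_zmod (L : Fin k → ℤ × ℤ) (p : ℕ) [NeZero p] :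
    omegaL L p = #(Finset.univ.filter fun x : ZMod p => ∏ i, formMod (L i) p x = 0) := by
  unfold omegaL
  refine Finset.card_bij' (fun n _ => ((n : ℕ) : ZMod p)) (fun x _ => x.val) ?_ ?_ ?_ ?_
  · intro n hn
    rw [Finset.mem_filter] at hn ⊢
    refine ⟨Finset.mem_univ _, ?_⟩
    have h2 := (natCast_dvd_prod_formEval_iff L p (n : ℤ)).mp hn.2
    simpa only [Int.cast_natCast] using h2
  · intro x hx
    rw [Finset.mem_filter] at hx ⊢
    refine ⟨Finset.mem_range.mpr (ZMod.val_lt x), ?_⟩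
    rw [natCast_dvd_prod_formEval_iff]
    simpa only [Int.cast_natCast, ZMod.natCast_zmod_val] using hx.2
  · intro n hn
    rw [Finset.mem_filter, Finset.mem_range] at hn
    exact ZMod.val_natCast_of_lt hn.1
  · intro x _
    exact ZMod.natCast_zmod_val x

/-- The least-index clause of `dkBox` in residue-class form. [cite: Maynard2016DenseClusters, §7] -/
theorem leastIndexClause_iff (L : Fin k → ℤ × ℤ) (j : Fin k) (s : ℕ) [NeZero s] :
    (∃ n ∈ Finset.range s, (s : ℤ) ∣ formEval (L j) n ∧ ∀ j' : Fin k, j' < j → ¬ (s : ℤ) ∣ formEval (L j') n) ↔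
      ∃ x : ZMod s, formMod (L j) s x = 0 ∧ ∀ j' : Fin k, j' < j → formMod (L j') s x ≠ 0 := by
  simp only [natCast_dvd_formEval_iff, Int.cast_natCast]
  exact exists_range_iff_exists_zmod (fun x => formMod (L j) s x = 0 ∧ ∀ j' : Fin k, j' < j → ¬ formMod (L j') s x = 0)

/-! ### Translation invariance -/

/-- The translated family: `(a, b) ↦ (a, b − a c)`, so that `L'ᵢ(n + c) = Lᵢ(n)`.
[cite: FordGreenKonyaginMaynardTao2018, §8 (translation steps)] -/
def shiftForms (L : Fin k → ℤ × ℤ) (c : ℤ) : Fin k → ℤ × ℤ :=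
  fun i => ((L i).1, (L i).2 - (L i).1 * c)

/-- `L'ᵢ(n + c) = Lᵢ(n)`. [cite: FordGreenKonyaginMaynardTao2018, §8] -/
theorem formEval_shiftForms (L : Fin k → ℤ × ℤ) (c n : ℤ) (i : Fin k) :
    formEval (shiftForms L c i) (n + c) = formEval (L i) n :=
  formEval_shift (L i) c n

/-- `L'ᵢ(n) = Lᵢ(n − c)`. [cite: FordGreenKonyaginMaynardTao2018, §8] -/
theorem formEval_shiftForms_sub (L : Fin k → ℤ × ℤ) (c n : ℤ) (i : Fin k) :
    formEval (shiftForms L c i) n = formEval (L i) (n - c) := by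
  have h := formEval_shift (L i) c (n - c)
  rwa [sub_add_cancel] at h

/-- `formMod L'ᵢ p x = formMod Lᵢ p (x − c)`. [cite: FordGreenKonyaginMaynardTao2018, §8] -/
theorem formMod_shiftForms (L : Fin k → ℤ × ℤ) (c : ℤ) (p : ℕ) (x : ZMod p) (i : Fin k) :
    formMod (shiftForms L c i) p x = formMod (L i) p (x - c) := by
  simp only [formMod, shiftForms, Int.cast_sub, Int.cast_mul]
  ring

/-- The leading coefficients are unchanged. [cite: FordGreenKonyaginMaynardTao2018, §8] -/
@[simp] theorem shiftForms_fst (L : Fin k → ℤ × ℤ) (c : ℤ) (i : Fin k) :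
    (shiftForms L c i).1 = (L i).1 := rfl

/-- Admissibility is translation invariant. [cite: FordGreenKonyaginMaynardTao2018, §8] -/
theorem formsAdmissible_shiftForms (L : Fin k → ℤ × ℤ) (c : ℤ) :
    FormsAdmissible (shiftForms L c) ↔ FormsAdmissible L := by
  unfold FormsAdmissible
  refine and_congr Iff.rfl (forall₂_congr fun p _ => ?_)
  simp only [formEval_shiftForms_sub]
  exact ⟨fun ⟨n, hn⟩ => ⟨n - c, hn⟩, fun ⟨n, hn⟩ => ⟨n + c, by simpa only [add_sub_cancel_right] using hn⟩⟩

/-- `ω` is translation invariant. [cite: FordGreenKonyaginMaynardTao2018, §8] -/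
theorem omegaL_shiftForms (L : Fin k → ℤ × ℤ) (c : ℤ) (p : ℕ) :
    omegaL (shiftForms L c) p = omegaL L p := by
  rcases Nat.eq_zero_or_pos p with rfl | hp
  · simp [omegaL]
  haveI : NeZero p := ⟨hp.ne'⟩
  rw [omegaL_eq_card_zmod, omegaL_eq_card_zmod]
  refine Finset.card_bij' (fun x _ => x - (c : ZMod p)) (fun x _ => x + (c : ZMod p)) ?_ ?_
    (fun x _ => sub_add_cancel x _) (fun x _ => add_sub_cancel_right x _)
  · intro x hx
    simp only [Finset.mem_filter, Finset.mem_univ, true_and, formMod_shiftForms] at hx ⊢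
    exact hx
  · intro x hx
    simp only [Finset.mem_filter, Finset.mem_univ, true_and, formMod_shiftForms] at hx ⊢
    simpa only [add_sub_cancel_right] using hx

/-- `𝒟_k` is translation invariant. [cite: FordGreenKonyaginMaynardTao2018, §8] -/
theorem dkBox_shiftForms (L : Fin k → ℤ × ℤ) (c : ℤ) (B : ℕ) (R : ℝ) :
    dkBox (shiftForms L c) B R = dkBox L B R := by
  unfold dkBox
  refine Finset.filter_congr fun d _ => ?_
  refine and_congr_right fun _ => and_congr Iff.rfl (forall_congr' fun j => forall₂_congr fun s hs => ?_)
  haveI : NeZero s := ⟨(Nat.prime_of_mem_primeFactors hs).ne_zero⟩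
  rw [leastIndexClause_iff, leastIndexClause_iff]
  simp only [formMod_shiftForms]
  exact ⟨fun ⟨x, hx⟩ => ⟨x - c, hx⟩, fun ⟨x, hx⟩ => ⟨x + c, by simpa only [add_sub_cancel_right] using hx⟩⟩

/-- The local factors are translation invariant. [cite: FordGreenKonyaginMaynardTao2018, §8] -/
theorem singFactor_shiftForms (L : Fin k → ℤ × ℤ) (c : ℤ) :
    singFactor (shiftForms L c) = singFactor L := by
  funext p
  simp only [singFactor, omegaL_shiftForms]

/-- The partial products are translation invariant. [cite: FordGreenKonyaginMaynardTao2018, §8] -/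
theorem singPartial_shiftForms (L : Fin k → ℤ × ℤ) (c : ℤ) :
    singPartial (shiftForms L c) = singPartial L := by
  funext D x
  simp only [singPartial, singFactor_shiftForms]

/-- `𝔖_D` is translation invariant. [cite: FordGreenKonyaginMaynardTao2018, §8] -/
theorem singSeriesExcl_shiftForms (L : Fin k → ℤ × ℤ) (c : ℤ) (D : ℕ) :
    singSeriesExcl (shiftForms L c) D = singSeriesExcl L D := by
  simp only [singSeriesExcl, singPartial_shiftForms]

/-- `φ_ω` is translation invariant. [cite: FordGreenKonyaginMaynardTao2018, §8] -/
theorem phiOmega_shiftForms (L : Fin k → ℤ × ℤ) (c : ℤ) :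
    phiOmega (shiftForms L c) = phiOmega L := by
  funext m
  simp only [phiOmega, omegaL_shiftForms]

/-- `y_r` is translation invariant. [cite: FordGreenKonyaginMaynardTao2018, §8] -/
theorem yVar_shiftForms (L : Fin k → ℤ × ℤ) (c : ℤ) (B : ℕ) (R : ℝ) (F : (Fin k → ℝ) → ℝ) :
    yVar (shiftForms L c) B R F = yVar L B R F := by
  funext r
  simp only [yVar, singSeriesExcl_shiftForms]

/-- `λ_d` is translation invariant. [cite: FordGreenKonyaginMaynardTao2018, §8] -/
theorem lamVar_shiftForms (L : Fin k → ℤ × ℤ) (c : ℤ) (B : ℕ) (R : ℝ) (F : (Fin k → ℝ) → ℝ) :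
    lamVar (shiftForms L c) B R F = lamVar L B R F := by
  funext d
  simp only [lamVar, dkBox_shiftForms, yVar_shiftForms, phiOmega_shiftForms]

/-- **Translation invariance of the sieve weight**: `w_{𝓛'}(n + c) = w_𝓛(n)` for the translated
family `𝓛' = shiftForms 𝓛 c` — the content of §8's "by translation" in the proofs of (6.3) and
(6.5). [cite: FordGreenKonyaginMaynardTao2018, §8] -/
theorem sieveWt_shiftForms (L : Fin k → ℤ × ℤ) (c : ℤ) (B : ℕ) (R : ℝ) (F : (Fin k → ℝ) → ℝ) (n : ℤ) :
    sieveWt (shiftForms L c) B R F (n + c) = sieveWt L B R F n := by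
  simp only [sieveWt, formEval_shiftForms, dkBox_shiftForms, lamVar_shiftForms]

/-- `Δ` is translation invariant (translating `L₀` as well). [cite: FordGreenKonyaginMaynardTao2018, §8] -/
theorem discDelta_shiftForms (L : Fin k → ℤ × ℤ) (c : ℤ) (l₀ : ℤ × ℤ) :
    discDelta (shiftForms L c) (l₀.1, l₀.2 - l₀.1 * c) = discDelta L l₀ := by
  unfold discDelta
  congr 1
  refine Finset.prod_congr rfl fun j _ => ?_
  simp only [shiftForms]
  congr 1
  ring

/-! ### The families `𝓛_p = {n + hᵢ p}` of §8 -/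

/-- §8's family `𝓛_p`: the forms `n ↦ n + hᵢ p` for a tuple enumerated as `h : Fin k → ℤ`
(`𝓛_1` is the tuple itself). [cite: FordGreenKonyaginMaynardTao2018, §8 proof of (6.3)] -/
def tupleForms (h : Fin k → ℤ) (p : ℕ) : Fin k → ℤ × ℤ := fun i => (1, h i * p)

/-- `ν_h(s)`: the number of residue classes mod `s` met by the tuple `h`.
[cite: FordGreenKonyaginMaynardTao2018, §6 (singular series)] -/
def tupleCount (h : Fin k → ℤ) (s : ℕ) : ℕ := #(Finset.univ.image fun i => ((h i : ℤ) : ZMod s))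

/-- For the increasing enumeration of a finite `H ⊆ ℤ`, `ν_h = ν_H` (`tupleResidueCount`).
[cite: FordGreenKonyaginMaynardTao2018, §6] -/
theorem tupleCount_orderEmbOfFin (H : Finset ℤ) {k : ℕ} (hk : H.card = k) (s : ℕ) :
    tupleCount (fun i => H.orderEmbOfFin hk i) s = tupleResidueCount H s := by
  unfold tupleCount tupleResidueCount
  rw [show H.image (fun h : ℤ => (h : ZMod s)) =
      (Finset.univ.image (H.orderEmbOfFin hk)).image (fun h : ℤ => (h : ZMod s)) by
    rw [Finset.image_orderEmbOfFin_univ], Finset.image_image]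
  rfl

/-- `ν_h(s) ≤ k`. [cite: FordGreenKonyaginMaynardTao2018, §6 (6.1)] -/
theorem tupleCount_le (h : Fin k → ℤ) (s : ℕ) : tupleCount h s ≤ k := by
  unfold tupleCount
  exact Finset.card_image_le.trans (by simp)

/-- `formMod` of the `i`-th form of `𝓛_p`: `x + hᵢ p`. [cite: FordGreenKonyaginMaynardTao2018, §8] -/
theorem formMod_tupleForms (h : Fin k → ℤ) (p s : ℕ) (x : ZMod s) (i : Fin k) :
    formMod (tupleForms h p i) s x = x + ((h i : ℤ) : ZMod s) * (p : ZMod s) := by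
  simp only [formMod, tupleForms, Int.cast_one, one_mul, Int.cast_mul, Int.cast_natCast]

/-- `𝓛_p` has leading coefficients `1`. [cite: FordGreenKonyaginMaynardTao2018, §8] -/
@[simp] theorem tupleForms_fst (h : Fin k → ℤ) (p : ℕ) (i : Fin k) : (tupleForms h p i).1 = 1 := rfl

/-- **Local counts of `𝓛_p` away from `p`**: for a prime `s ∤ p`, `ω_{𝓛_p}(s) = ν_h(s)` (the roots
`−hᵢ p` are the classes of `h` up to the unit `−p`). [cite: FordGreenKonyaginMaynardTao2018, §8 proof of (6.3)] -/
theorem omegaL_tupleForms (h : Fin k → ℤ) {p s : ℕ} (hs : s.Prime) (hsp : ¬ s ∣ p) :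
    omegaL (tupleForms h p) s = tupleCount h s := by
  haveI := Fact.mk hs
  have hp0 : (p : ZMod s) ≠ 0 := by
    rwa [Ne, ZMod.natCast_eq_zero_iff]
  rw [omegaL_eq_card_zmod]
  have hset : (Finset.univ.filter fun x : ZMod s => ∏ i, formMod (tupleForms h p i) s x = 0) =
      (Finset.univ.image fun i => ((h i : ℤ) : ZMod s)).image fun y => -(y * (p : ZMod s)) := by
    ext x
    simp only [Finset.mem_filter, Finset.mem_univ, true_and, Finset.mem_image, formMod_tupleForms,
      Finset.prod_eq_zero_iff, exists_exists_eq_and]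
    constructor
    · rintro ⟨i, hi⟩
      exact ⟨i, by linear_combination -hi⟩
    · rintro ⟨i, hi⟩
      exact ⟨i, by rw [← hi]; ring⟩
  rw [hset, Finset.card_image_of_injective _ ?_]
  · rfl
  · intro y₁ y₂ hy
    have : y₁ * (p : ZMod s) = y₂ * (p : ZMod s) := neg_injective hy
    exact mul_right_cancel₀ hp0 this

/-- **The local count of `𝓛_p` at `p`** (`p` prime, `k ≥ 1`): all forms reduce to `n`, so
`ω_{𝓛_p}(p) = 1`. [cite: FordGreenKonyaginMaynardTao2018, §8 proof of (6.3)] -/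
theorem omegaL_tupleForms_self (h : Fin k → ℤ) {p : ℕ} (hp : p.Prime) (hk : k ≠ 0) :
    omegaL (tupleForms h p) p = 1 := by
  haveI := Fact.mk hp
  rw [omegaL_eq_card_zmod]
  have hset : (Finset.univ.filter fun x : ZMod p => ∏ i, formMod (tupleForms h p i) p x = 0) = {0} := by
    ext x
    simp only [Finset.mem_filter, Finset.mem_univ, true_and, Finset.mem_singleton, formMod_tupleForms,
      ZMod.natCast_self, mul_zero, add_zero, Finset.prod_const, Finset.card_univ, Fintype.card_fin]
    exact pow_eq_zero_iff hk
  rw [hset, Finset.card_singleton]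

/-- The local factor of `𝓛_p` at a prime `s ∤ p` is the Hardy–Littlewood factor of the tuple.
[cite: FordGreenKonyaginMaynardTao2018, §8] -/
theorem singFactor_tupleForms (h : Fin k → ℤ) {p s : ℕ} (hs : s.Prime) (hsp : ¬ s ∣ p) :
    singFactor (tupleForms h p) s = (1 - (tupleCount h s : ℝ) / s) * (1 - 1 / (s : ℝ))⁻¹ ^ k := by
  simp only [singFactor, omegaL_tupleForms h hs hsp]

/-- The local factor of `𝓛_p` at `p`: `(1 − 1/p)(1 − 1/p)^{−k}`. [cite: FordGreenKonyaginMaynardTao2018, §8] -/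
theorem singFactor_tupleForms_self (h : Fin k → ℤ) {p : ℕ} (hp : p.Prime) (hk : k ≠ 0) :
    singFactor (tupleForms h p) p = (1 - 1 / (p : ℝ)) * (1 - 1 / (p : ℝ))⁻¹ ^ k := by
  simp only [singFactor, omegaL_tupleForms_self h hp hk, Nat.cast_one]

/-- For primes `s ≠ p` (`p` prime or `1`), the local factors of `𝓛_p` and `𝓛_1` agree.
[cite: FordGreenKonyaginMaynardTao2018, §8] -/
theorem singFactor_tupleForms_eq_one (h : Fin k → ℤ) {p s : ℕ} (hs : s.Prime) (hsp : ¬ s ∣ p) :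
    singFactor (tupleForms h p) s = singFactor (tupleForms h 1) s := by
  rw [singFactor_tupleForms h hs hsp, singFactor_tupleForms h hs (Nat.Prime.not_dvd_one hs)]

/-- Two families whose local factors agree at all primes `s ≠ p` have partial products differing
exactly in the factor at `p`: for `p` prime, `p ∤ D`, `p ≤ x`,
`singPartial 𝓛 D x · f_{𝓛'}(p) = singPartial 𝓛' D x · f_𝓛(p)`. [cite: FordGreenKonyaginMaynardTao2018, §8] -/
theorem singPartial_mul_singFactor_of_agree {L L' : Fin k → ℤ × ℤ} {p D x : ℕ} (hp : p.Prime)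
    (hpD : ¬ p ∣ D) (hpx : p ≤ x) (hagree : ∀ s : ℕ, s.Prime → s ≠ p → singFactor L s = singFactor L' s) :
    singPartial L D x * singFactor L' p = singPartial L' D x * singFactor L p := by
  unfold singPartial
  have hmem : p ∈ (Finset.range (x + 1)).filter (fun q => q.Prime ∧ ¬ q ∣ D) := by
    simp only [Finset.mem_filter, Finset.mem_range]
    exact ⟨Nat.lt_succ_of_le hpx, hp, hpD⟩
  rw [← Finset.mul_prod_erase _ _ hmem, ← Finset.mul_prod_erase _ (singFactor L') hmem]
  have hrest : ∏ q ∈ ((Finset.range (x + 1)).filter (fun q => q.Prime ∧ ¬ q ∣ D)).erase p, singFactor L q =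
      ∏ q ∈ ((Finset.range (x + 1)).filter (fun q => q.Prime ∧ ¬ q ∣ D)).erase p, singFactor L' q := by
    refine Finset.prod_congr rfl fun q hq => ?_
    rw [Finset.mem_erase, Finset.mem_filter] at hq
    exact hagree q hq.2.2.1 hq.1
  rw [hrest]
  ring

/-- Two families whose local factors agree at all primes `s ≠ p` have the same partial products
when `p` does not occur (`p ∣ D` or `x < p`). [cite: FordGreenKonyaginMaynardTao2018, §8] -/
theorem singPartial_eq_of_agree {L L' : Fin k → ℤ × ℤ} {p D x : ℕ} (hpDx : p ∣ D ∨ x < p)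
    (hagree : ∀ s : ℕ, s.Prime → s ≠ p → singFactor L s = singFactor L' s) :
    singPartial L D x = singPartial L' D x := by
  unfold singPartial
  refine Finset.prod_congr rfl fun q hq => ?_
  rw [Finset.mem_filter, Finset.mem_range] at hq
  refine hagree q hq.2.1 ?_
  rintro rfl
  rcases hpDx with hD | hx
  · exact hq.2.2 hD
  · omega

/-- **Partial products of `𝔖_D(𝓛_p)` vs `𝔖_D(𝓛_1)`** — they differ exactly in the factor at `p`:
for `p` prime, `p ∤ D`, `p ≤ x`,
`singPartial 𝓛_p D x · f_{𝓛_1}(p) = singPartial 𝓛_1 D x · f_{𝓛_p}(p)`. With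
`f_{𝓛_p}(p)/f_{𝓛_1}(p) = (1 − 1/p)/(1 − ν(p)/p) = 1 + O(k/p)` this is §8's
"`𝔖(𝓛_p) = (1 + O(k/x)) 𝔖` independent of `p`". [cite: FordGreenKonyaginMaynardTao2018, §8 proof of (6.3)] -/
theorem singPartial_tupleForms_mul (h : Fin k → ℤ) {p : ℕ} (hp : p.Prime) {D x : ℕ} (hpD : ¬ p ∣ D)
    (hpx : p ≤ x) :
    singPartial (tupleForms h p) D x * singFactor (tupleForms h 1) p =
      singPartial (tupleForms h 1) D x * singFactor (tupleForms h p) p :=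
  singPartial_mul_singFactor_of_agree hp hpD hpx fun _ hs hsp =>
    singFactor_tupleForms_eq_one h hs fun hdvd => hsp ((Nat.prime_dvd_prime_iff_eq hs hp).mp hdvd)

/-- Away from `p` the partial products agree: if `p ∣ D` or `x < p` then
`singPartial 𝓛_p D x = singPartial 𝓛_1 D x`. [cite: FordGreenKonyaginMaynardTao2018, §8] -/
theorem singPartial_tupleForms_of_not_mem (h : Fin k → ℤ) {p : ℕ} (hp : p.Prime) {D x : ℕ}
    (hpDx : p ∣ D ∨ x < p) :
    singPartial (tupleForms h p) D x = singPartial (tupleForms h 1) D x :=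
  singPartial_eq_of_agree hpDx fun _ hs hsp =>
    singFactor_tupleForms_eq_one h hs fun hdvd => hsp ((Nat.prime_dvd_prime_iff_eq hs hp).mp hdvd)

/-! ### `𝒟_k(𝓛_p)` does not depend on `p` -/

/-- The `p`-free description of the support: `d` in the box `[1, R]^k` with `∏ dᵢ` squarefree and
coprime to `W·B`. [cite: FordGreenKonyaginMaynardTao2018, §8 proof of (6.3)] -/
noncomputable def dkBoxCoprime (k B : ℕ) (R : ℝ) : Finset (Fin k → ℕ) :=
  (Fintype.piFinset fun _ : Fin k => Finset.Icc 1 ⌊R⌋₊).filter fun d =>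
    Squarefree (∏ i, d i) ∧ Nat.Coprime (∏ i, d i) (wCut k B * B)

/-- `𝒟_k(𝓛) ⊆` the `p`-free box, for every family. [cite: Maynard2016DenseClusters, §7 (7.4)] -/
theorem dkBox_subset_dkBoxCoprime (L : Fin k → ℤ × ℤ) (B : ℕ) (R : ℝ) :
    dkBox L B R ⊆ dkBoxCoprime k B R := by
  intro d hd
  unfold dkBox at hd
  unfold dkBoxCoprime
  rw [Finset.mem_filter] at hd ⊢
  exact ⟨hd.1, hd.2.1, hd.2.2.1⟩

/-- A prime not dividing `W = wCut k B` and not dividing `B` exceeds `2k²`.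
[cite: Maynard2016DenseClusters, §7 (definition of W)] -/
theorem lt_of_prime_not_dvd_wCut {B s : ℕ} (hs : s.Prime) (hsW : ¬ s ∣ wCut k B) (hsB : ¬ s ∣ B) :
    2 * k ^ 2 < s := by
  by_contra hle
  refine hsW (Finset.dvd_prod_of_mem _ ?_)
  simp only [Finset.mem_filter, Finset.mem_range]
  exact ⟨by omega, hs, hsB⟩

/-- **`𝒟_k(𝓛_p)` is independent of `p`** (§8: "for primes `s ∤ p W B` with `s ≤ R`, the `hᵢ p`
are distinct mod `s`, so `𝒟_k(𝓛_p) ∩ {∏ dᵢ ≤ R}` does not depend on `p`"): if `p > R` is prime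
and the `hᵢ` are pairwise incongruent modulo every prime `s > 2k²`, then `dkBox (𝓛_p) B R` is the
`p`-free box. [cite: FordGreenKonyaginMaynardTao2018, §8 proof of (6.3)] -/
theorem dkBox_tupleForms (h : Fin k → ℤ) {p : ℕ} (hp : p.Prime) {B : ℕ} {R : ℝ} (hRp : ⌊R⌋₊ < p)
    (hh : ∀ s : ℕ, s.Prime → 2 * k ^ 2 < s → ∀ i j : Fin k, i ≠ j → ¬ (s : ℤ) ∣ h i - h j) :
    dkBox (tupleForms h p) B R = dkBoxCoprime k B R := by
  unfold dkBox dkBoxCoprime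
  refine Finset.filter_congr fun d hd => ?_
  refine ⟨fun hc => ⟨hc.1, hc.2.1⟩, fun hc => ⟨hc.1, hc.2, fun j s hs => ?_⟩⟩
  have hsprime : s.Prime := Nat.prime_of_mem_primeFactors hs
  have hsd : s ∣ d j := Nat.dvd_of_mem_primeFactors hs
  haveI := Fact.mk hsprime
  have hsprod : s ∣ ∏ i, d i := hsd.trans (Finset.dvd_prod_of_mem _ (Finset.mem_univ j))
  have hsWB : ¬ s ∣ wCut k B * B :=
    (Nat.Prime.coprime_iff_not_dvd hsprime).mp (Nat.Coprime.coprime_dvd_left hsprod hc.2)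
  have hsW : ¬ s ∣ wCut k B := fun h' => hsWB (h'.mul_right B)
  have hsB : ¬ s ∣ B := fun h' => hsWB (h'.mul_left _)
  have h2k : 2 * k ^ 2 < s := lt_of_prime_not_dvd_wCut hsprime hsW hsB
  have hdj : d j ∈ Finset.Icc 1 ⌊R⌋₊ := Fintype.mem_piFinset.mp hd j
  rw [Finset.mem_Icc] at hdj
  have hsR : s ≤ ⌊R⌋₊ := (Nat.le_of_dvd (by omega) hsd).trans hdj.2
  have hsp : ¬ s ∣ p := fun hdvd => by
    have := (Nat.prime_dvd_prime_iff_eq hsprime hp).mp hdvd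
    omega
  have hp0 : (p : ZMod s) ≠ 0 := by
    rwa [Ne, ZMod.natCast_eq_zero_iff]
  rw [leastIndexClause_iff]
  refine ⟨-(((h j : ℤ) : ZMod s) * (p : ZMod s)), ?_, fun j' hj' => ?_⟩
  · rw [formMod_tupleForms, neg_add_cancel]
  · rw [formMod_tupleForms]
    have hne : ((h j' : ℤ) : ZMod s) - ((h j : ℤ) : ZMod s) ≠ 0 := by
      rw [← Int.cast_sub, Ne, ZMod.intCast_zmod_eq_zero_iff_dvd]
      exact hh s hsprime h2k j' j (ne_of_lt hj')
    have : -(((h j : ℤ) : ZMod s) * (p : ZMod s)) + ((h j' : ℤ) : ZMod s) * (p : ZMod s) =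
        (((h j' : ℤ) : ZMod s) - ((h j : ℤ) : ZMod s)) * (p : ZMod s) := by ring
    rw [this]
    exact mul_ne_zero hne hp0

/-- For `r` in the `p`-free box all prime factors of `∏ rᵢ` are `≤ ⌊R⌋`.
[cite: Maynard2016DenseClusters, §7] -/
theorem prime_le_of_mem_dkBoxCoprime {B : ℕ} {R : ℝ} {r : Fin k → ℕ} (hr : r ∈ dkBoxCoprime k B R)
    {s : ℕ} (hs : s ∈ (∏ i, r i).primeFactors) : s ≤ ⌊R⌋₊ := by
  unfold dkBoxCoprime at hr
  rw [Finset.mem_filter] at hr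
  have hsprime : s.Prime := Nat.prime_of_mem_primeFactors hs
  haveI := Fact.mk hsprime
  have hsd : s ∣ ∏ i, r i := Nat.dvd_of_mem_primeFactors hs
  obtain ⟨i, -, hi⟩ := (Nat.Prime.prime hsprime).exists_mem_finset_dvd hsd
  have hri : r i ∈ Finset.Icc 1 ⌊R⌋₊ := Fintype.mem_piFinset.mp hr.1 i
  rw [Finset.mem_Icc] at hri
  exact (Nat.le_of_dvd (by omega) hi).trans hri.2

/-- **`φ_ω` of `𝓛_p` on the support is independent of `p`**: if all prime factors of `m` are
primes `≠ p` then `φ_{ω,𝓛_p}(m) = φ_{ω,𝓛_1}(m)`. [cite: FordGreenKonyaginMaynardTao2018, §8 proof of (6.3)] -/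
theorem phiOmega_tupleForms (h : Fin k → ℤ) {p : ℕ} (hp : p.Prime) {m : ℕ}
    (hm : ∀ s ∈ m.primeFactors, s ≠ p) :
    phiOmega (tupleForms h p) m = phiOmega (tupleForms h 1) m := by
  unfold phiOmega
  refine Finset.prod_congr rfl fun s hs => ?_
  have hsprime : s.Prime := Nat.prime_of_mem_primeFactors hs
  have hsp : ¬ s ∣ p := fun hdvd => hm s hs ((Nat.prime_dvd_prime_iff_eq hsprime hp).mp hdvd)
  rw [omegaL_tupleForms h hsprime hsp, omegaL_tupleForms h hsprime (Nat.Prime.not_dvd_one hsprime)]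

/-- `φ_{ω,𝓛_p} = φ_{ω,𝓛_1}` on `{∏ rᵢ : r ∈ 𝒟}` when `p > R`. [cite: FordGreenKonyaginMaynardTao2018, §8] -/
theorem phiOmega_tupleForms_of_mem (h : Fin k → ℤ) {p : ℕ} (hp : p.Prime) {B : ℕ} {R : ℝ}
    (hRp : ⌊R⌋₊ < p) {r : Fin k → ℕ} (hr : r ∈ dkBoxCoprime k B R) :
    phiOmega (tupleForms h p) (∏ i, r i) = phiOmega (tupleForms h 1) (∏ i, r i) :=
  phiOmega_tupleForms h hp fun s hs => by
    have := prime_le_of_mem_dkBoxCoprime hr hs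
    omega

/-- A tuple in `[1, 2k²]` with distinct entries is incongruent modulo every prime `s > 2k²` — the
hypothesis of `dkBox_tupleForms` for the tuples of Theorem 5. [cite: FordGreenKonyaginMaynardTao2018, §8] -/
theorem tuple_incongruent_of_bounds (h : Fin k → ℤ) (hinj : Function.Injective h)
    (hb : ∀ i, 1 ≤ h i ∧ h i ≤ 2 * (k : ℤ) ^ 2) :
    ∀ s : ℕ, s.Prime → 2 * k ^ 2 < s → ∀ i j : Fin k, i ≠ j → ¬ (s : ℤ) ∣ h i - h j := by
  intro s _ hs i j hij hdvd
  have hne : h i - h j ≠ 0 := sub_ne_zero.mpr (hinj.ne hij)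
  have hlt : |h i - h j| < (s : ℤ) := by
    have hi := hb i
    have hj := hb j
    have : (2 * k ^ 2 : ℕ) < (s : ℤ) := by exact_mod_cast hs
    push_cast at this
    rw [abs_lt]
    constructor <;> linarith
  exact hne (Int.eq_zero_of_abs_lt_dvd hdvd hlt)

/-- Under the same bounds, `ν_h(s) = k` for primes `s > 2k²`. [cite: FordGreenKonyaginMaynardTao2018, §6 (6.1)] -/
theorem tupleCount_eq_of_incongruent (h : Fin k → ℤ) {s : ℕ}
    (hh : ∀ i j : Fin k, i ≠ j → ¬ (s : ℤ) ∣ h i - h j) : tupleCount h s = k := by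
  unfold tupleCount
  rw [Finset.card_image_of_injective _ ?_, Finset.card_univ, Fintype.card_fin]
  intro i j hij
  by_contra hne
  refine hh i j hne ?_
  rw [← ZMod.intCast_zmod_eq_zero_iff_dvd, Int.cast_sub]
  exact sub_eq_zero.mpr hij

/-! ### Comparing two families with the same support -/

/-- **Comparison of `λ_d` for two families with the same support data**: if `𝒟_k(𝓛) = 𝒟_k(𝓛')`
and `φ_{ω,𝓛} = φ_{ω,𝓛'}` on `{∏ rᵢ : r ∈ 𝒟_k}`, then `λ_d(𝓛) 𝔖_{WB}(𝓛') = λ_d(𝓛') 𝔖_{WB}(𝓛)` for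
every `d` — the `λ`'s are proportional, with ratio the ratio of singular series (§8, proof of
(6.4): "it follows that `w(p, q − h_i p) = (1 + O(k/x)) w̃(L̃_{q,i})`").
[cite: FordGreenKonyaginMaynardTao2018, §8 proof of (6.4)] -/
theorem lamVar_mul_singSeriesExcl {L L' : Fin k → ℤ × ℤ} {B : ℕ} {R : ℝ} (F : (Fin k → ℝ) → ℝ)
    (hD : dkBox L B R = dkBox L' B R)
    (hφ : ∀ r ∈ dkBox L B R, phiOmega L (∏ i, r i) = phiOmega L' (∏ i, r i)) (d : Fin k → ℕ) :
    lamVar L B R F d * singSeriesExcl L' (wCut k B * B) =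
      lamVar L' B R F d * singSeriesExcl L (wCut k B * B) := by
  unfold lamVar
  rw [← hD]
  have hsum : (∑ r ∈ (dkBox L B R).filter (fun r => ∀ i, d i ∣ r i), yVar L B R F r / phiOmega L (∏ i, r i)) *
      singSeriesExcl L' (wCut k B * B) =
      (∑ r ∈ (dkBox L B R).filter (fun r => ∀ i, d i ∣ r i), yVar L' B R F r / phiOmega L' (∏ i, r i)) *
      singSeriesExcl L (wCut k B * B) := by
    rw [Finset.sum_mul, Finset.sum_mul]
    refine Finset.sum_congr rfl fun r hr => ?_
    rw [hφ r (Finset.mem_filter.mp hr).1]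
    unfold yVar
    ring
  calc _ = ((ArithmeticFunction.moebius (∏ i, d i) : ℤ) : ℝ) * (∏ i, (d i : ℝ)) *
        ((∑ r ∈ (dkBox L B R).filter (fun r => ∀ i, d i ∣ r i), yVar L B R F r / phiOmega L (∏ i, r i)) *
          singSeriesExcl L' (wCut k B * B)) := by ring
    _ = _ := by rw [hsum]; ring

/-- **Comparison of the weights**: under the hypotheses of `lamVar_mul_singSeriesExcl`, if at the
two arguments `n`, `n'` the cut-off conditions are equivalent and the same `d ∈ 𝒟_k` divide the
form values, then `w_𝓛(n) · 𝔖_{WB}(𝓛')² = w_{𝓛'}(n') · 𝔖_{WB}(𝓛)²`. In §8 (proof of (6.4)) this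
is applied with `𝓛 = 𝓛_p`, `n = q − hᵢ p`, `𝓛' = L̃_{q,i}`, `n' = p`: the form values agree except
at the index `i`, where they are the primes `q` resp. `p`, both `> R` and coprime to `W`.
[cite: FordGreenKonyaginMaynardTao2018, §8 proof of (6.4)] -/
theorem sieveWt_mul_sq_singSeriesExcl {L L' : Fin k → ℤ × ℤ} {B : ℕ} {R : ℝ} (F : (Fin k → ℝ) → ℝ)
    (hD : dkBox L B R = dkBox L' B R)
    (hφ : ∀ r ∈ dkBox L B R, phiOmega L (∏ i, r i) = phiOmega L' (∏ i, r i)) {n n' : ℤ}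
    (hcut : (∀ i, Int.gcd (formEval (L i) n) (wCut k B) = 1) ↔
      ∀ i, Int.gcd (formEval (L' i) n') (wCut k B) = 1)
    (hdiv : ∀ d ∈ dkBox L B R, (∀ i, ((d i : ℕ) : ℤ) ∣ formEval (L i) n) ↔
      ∀ i, ((d i : ℕ) : ℤ) ∣ formEval (L' i) n') :
    sieveWt L B R F n * singSeriesExcl L' (wCut k B * B) ^ 2 =
      sieveWt L' B R F n' * singSeriesExcl L (wCut k B * B) ^ 2 := by
  have hF : (dkBox L B R).filter (fun d => ∀ i, ((d i : ℕ) : ℤ) ∣ formEval (L i) n) =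
      (dkBox L' B R).filter (fun d => ∀ i, ((d i : ℕ) : ℤ) ∣ formEval (L' i) n') := by
    rw [← hD]
    exact Finset.filter_congr fun d hd => hdiv d hd
  by_cases hc : ∀ i, Int.gcd (formEval (L i) n) (wCut k B) = 1
  · have hc' : ∀ i, Int.gcd (formEval (L' i) n') (wCut k B) = 1 := hcut.mp hc
    rw [sieveWt, if_pos hc, sieveWt, if_pos hc', hF, ← mul_pow, ← mul_pow, Finset.sum_mul,
      Finset.sum_mul]
    exact congrArg (fun t : ℝ => t ^ 2) (Finset.sum_congr rfl fun d _ => lamVar_mul_singSeriesExcl F hD hφ d)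
  · have hc' : ¬ ∀ i, Int.gcd (formEval (L' i) n') (wCut k B) = 1 := fun h' => hc (hcut.mpr h')
    rw [sieveWt, if_neg hc, sieveWt, if_neg hc', zero_mul, zero_mul]

/-- The special case of `sieveWt_mul_sq_singSeriesExcl` where the form values agree literally,
`Lᵢ(n) = L'ᵢ(n')` for all `i`. [cite: FordGreenKonyaginMaynardTao2018, §8] -/
theorem sieveWt_mul_sq_singSeriesExcl_of_formEval_eq {L L' : Fin k → ℤ × ℤ} {B : ℕ} {R : ℝ}
    (F : (Fin k → ℝ) → ℝ) (hD : dkBox L B R = dkBox L' B R)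
    (hφ : ∀ r ∈ dkBox L B R, phiOmega L (∏ i, r i) = phiOmega L' (∏ i, r i)) {n n' : ℤ}
    (hval : ∀ i, formEval (L i) n = formEval (L' i) n') :
    sieveWt L B R F n * singSeriesExcl L' (wCut k B * B) ^ 2 =
      sieveWt L' B R F n' * singSeriesExcl L (wCut k B * B) ^ 2 :=
  sieveWt_mul_sq_singSeriesExcl F hD hφ (by simp only [hval]) (fun d _ => by simp only [hval])

/-- `y_r` of two families are proportional to their `𝔖_{WB}`. [cite: FordGreenKonyaginMaynardTao2018, §8] -/
theorem yVar_mul_singSeriesExcl (L L' : Fin k → ℤ × ℤ) (B : ℕ) (R : ℝ) (F : (Fin k → ℝ) → ℝ)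
    (r : Fin k → ℕ) :
    yVar L B R F r * singSeriesExcl L' (wCut k B * B) = yVar L' B R F r * singSeriesExcl L (wCut k B * B) := by
  unfold yVar
  ring

/-! ### The family `L̃_{q,i₀}` of §8 (proof of (6.4)) -/

/-- §8's family `L̃_{q,i₀}`: `L̃_{i₀}(n) = n` and `L̃_j(n) = (h_j − h_{i₀}) n + q` for `j ≠ i₀`.
[cite: FordGreenKonyaginMaynardTao2018, §8 proof of (6.4)] -/
def wbpForms (h : Fin k → ℤ) (q : ℕ) (i₀ : Fin k) : Fin k → ℤ × ℤ :=
  fun j => if j = i₀ then (1, 0) else (h j - h i₀, q)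

/-- `L̃_{i₀}(n) = n`. [cite: FordGreenKonyaginMaynardTao2018, §8] -/
theorem formEval_wbpForms_self (h : Fin k → ℤ) (q : ℕ) (i₀ : Fin k) (n : ℤ) :
    formEval (wbpForms h q i₀ i₀) n = n := by
  simp [wbpForms, formEval]

/-- `L̃_j(n) = (h_j − h_{i₀}) n + q` for `j ≠ i₀`. [cite: FordGreenKonyaginMaynardTao2018, §8] -/
theorem formEval_wbpForms_of_ne (h : Fin k → ℤ) (q : ℕ) {i₀ j : Fin k} (hj : j ≠ i₀) (n : ℤ) :
    formEval (wbpForms h q i₀ j) n = (h j - h i₀) * n + q := by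
  simp [wbpForms, formEval, hj]

/-- **The value identity behind (6.4)**: for `j ≠ i₀`, `L̃_j(p) = L_j(q − h_{i₀} p)` where
`𝓛_p = {n + h_j p}`. [cite: FordGreenKonyaginMaynardTao2018, §8 proof of (6.4)] -/
theorem formEval_wbpForms_eq (h : Fin k → ℤ) (q p : ℕ) {i₀ j : Fin k} (hj : j ≠ i₀) :
    formEval (wbpForms h q i₀ j) p = formEval (tupleForms h p j) ((q : ℤ) - h i₀ * p) := by
  rw [formEval_wbpForms_of_ne h q hj]
  simp only [formEval, tupleForms]
  ring

/-- At the index `i₀` the values are `L̃_{i₀}(p) = p` and `L_{i₀}(q − h_{i₀} p) = q`.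
[cite: FordGreenKonyaginMaynardTao2018, §8 proof of (6.4)] -/
theorem formEval_tupleForms_sub (h : Fin k → ℤ) (q p : ℕ) (i₀ : Fin k) :
    formEval (tupleForms h p i₀) ((q : ℤ) - h i₀ * p) = q := by
  simp only [formEval, tupleForms]
  ring

/-- `formMod` of `L̃_{i₀}`. [cite: FordGreenKonyaginMaynardTao2018, §8] -/
theorem formMod_wbpForms_self (h : Fin k → ℤ) (q : ℕ) (i₀ : Fin k) (s : ℕ) (x : ZMod s) :
    formMod (wbpForms h q i₀ i₀) s x = x := by
  simp [wbpForms, formMod]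

/-- `formMod` of `L̃_j`, `j ≠ i₀`. [cite: FordGreenKonyaginMaynardTao2018, §8] -/
theorem formMod_wbpForms_of_ne (h : Fin k → ℤ) (q : ℕ) {i₀ j : Fin k} (hj : j ≠ i₀) (s : ℕ) (x : ZMod s) :
    formMod (wbpForms h q i₀ j) s x = (((h j : ℤ) : ZMod s) - ((h i₀ : ℤ) : ZMod s)) * x + (q : ZMod s) := by
  simp [wbpForms, formMod, hj]

/-- The root set of `L̃_{q,i₀}` modulo a prime `s ∤ q`, described through `∃ j`.
[cite: FordGreenKonyaginMaynardTao2018, §8] -/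
theorem prod_formMod_wbpForms_eq_zero_iff (h : Fin k → ℤ) {q s : ℕ} (hs : s.Prime) (i₀ : Fin k)
    (x : ZMod s) :
    (haveI := Fact.mk hs; ∏ j, formMod (wbpForms h q i₀ j) s x = 0 ↔
      x = 0 ∨ ∃ j, j ≠ i₀ ∧ (((h j : ℤ) : ZMod s) - ((h i₀ : ℤ) : ZMod s)) * x + (q : ZMod s) = 0) := by
  haveI := Fact.mk hs
  rw [Finset.prod_eq_zero_iff]
  constructor
  · rintro ⟨j, -, hj⟩
    by_cases hji : j = i₀
    · subst hji
      left
      rwa [formMod_wbpForms_self] at hj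
    · right
      exact ⟨j, hji, by rwa [formMod_wbpForms_of_ne h q hji] at hj⟩
  · rintro (hx | ⟨j, hji, hj⟩)
    · exact ⟨i₀, Finset.mem_univ _, by rw [formMod_wbpForms_self, hx]⟩
    · exact ⟨j, Finset.mem_univ _, by rwa [formMod_wbpForms_of_ne h q hji]⟩

/-- **Local counts of `L̃_{q,i₀}`** (the small-prime point of §8's "𝔖(L̃_{q,i}) = (1 + O(k/x))𝔖"):
for every prime `s ∤ q`, `ω_{L̃_{q,i₀}}(s) = ν_h(s)`. The bijection from the roots onto the classes
`{h_j mod s}` is `x ↦ h_{i₀} − q x⁻¹` (with `0⁻¹ = 0`: the root `0` of `L̃_{i₀}` goes to the class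
of `h_{i₀}`, which is exactly the class of those `h_j` whose form `L̃_j` has no root).
[cite: FordGreenKonyaginMaynardTao2018, §8 proof of (6.4)] -/
theorem omegaL_wbpForms (h : Fin k → ℤ) {q s : ℕ} (hs : s.Prime) (hsq : ¬ s ∣ q) (i₀ : Fin k) :
    omegaL (wbpForms h q i₀) s = tupleCount h s := by
  haveI := Fact.mk hs
  have hq0 : (q : ZMod s) ≠ 0 := by
    rwa [Ne, ZMod.natCast_eq_zero_iff]
  rw [omegaL_eq_card_zmod]
  unfold tupleCount
  set H₀ : ZMod s := ((h i₀ : ℤ) : ZMod s) with hH₀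
  refine Finset.card_bij' (fun x _ => H₀ - (q : ZMod s) * x⁻¹) (fun c _ => (q : ZMod s) * (H₀ - c)⁻¹)
    ?_ ?_ ?_ ?_
  · intro x hx
    rw [Finset.mem_filter] at hx
    rw [Finset.mem_image]
    rcases (prod_formMod_wbpForms_eq_zero_iff h hs i₀ x).mp hx.2 with hx0 | ⟨j, hji, hj⟩
    · exact ⟨i₀, Finset.mem_univ _, by rw [hx0, inv_zero, mul_zero, sub_zero]⟩
    · refine ⟨j, Finset.mem_univ _, ?_⟩
      have hx0 : x ≠ 0 := by
        rintro rfl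
        rw [mul_zero, zero_add] at hj
        exact hq0 hj
      have : (q : ZMod s) = -((((h j : ℤ) : ZMod s) - H₀) * x) := by linear_combination hj
      rw [this, neg_mul, mul_assoc, mul_inv_cancel₀ hx0, mul_one]
      ring
  · intro c hc
    rw [Finset.mem_image] at hc
    obtain ⟨j, -, rfl⟩ := hc
    rw [Finset.mem_filter]
    refine ⟨Finset.mem_univ _, (prod_formMod_wbpForms_eq_zero_iff h hs i₀ _).mpr ?_⟩
    by_cases hji : ((h j : ℤ) : ZMod s) = H₀
    · left
      rw [hji, sub_self, inv_zero, mul_zero]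
    · right
      have hne : H₀ - ((h j : ℤ) : ZMod s) ≠ 0 := sub_ne_zero.mpr (Ne.symm hji)
      refine ⟨j, fun hj => hji (by rw [hj]), ?_⟩
      rw [show (((h j : ℤ) : ZMod s) - H₀) = -(H₀ - ((h j : ℤ) : ZMod s)) by ring, neg_mul, ← mul_assoc,
        mul_comm (H₀ - _) (q : ZMod s), mul_assoc, mul_inv_cancel₀ hne, mul_one, neg_add_cancel]
  · intro x _
    rw [sub_sub_cancel, mul_inv, inv_inv, mul_inv_cancel_left₀ hq0]
  · intro c _
    rw [mul_inv, inv_inv, mul_inv_cancel_left₀ hq0, sub_sub_cancel]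

/-- The local count of `L̃_{q,i₀}` at `q` (`q` prime, the `h_j` incongruent to `h_{i₀}` mod `q`):
only the root `0`, so `ω(q) = 1`. [cite: FordGreenKonyaginMaynardTao2018, §8 proof of (6.4)] -/
theorem omegaL_wbpForms_self (h : Fin k → ℤ) {q : ℕ} (hq : q.Prime) (i₀ : Fin k)
    (hh : ∀ j : Fin k, j ≠ i₀ → ¬ (q : ℤ) ∣ h j - h i₀) :
    omegaL (wbpForms h q i₀) q = 1 := by
  haveI := Fact.mk hq
  rw [omegaL_eq_card_zmod]
  have hset : (Finset.univ.filter fun x : ZMod q => ∏ j, formMod (wbpForms h q i₀ j) q x = 0) = {0} := by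
    ext x
    rw [Finset.mem_filter, Finset.mem_singleton, prod_formMod_wbpForms_eq_zero_iff h hq]
    simp only [Finset.mem_univ, true_and, ZMod.natCast_self, add_zero]
    constructor
    · rintro (hx | ⟨j, hji, hj⟩)
      · exact hx
      · rcases mul_eq_zero.mp hj with hd | hx
        · exact absurd hd (by
            rw [← Int.cast_sub, ZMod.intCast_zmod_eq_zero_iff_dvd]
            exact hh j hji)
        · exact hx
    · intro hx
      exact Or.inl hx
  rw [hset, Finset.card_singleton]

/-- The local factors of `L̃_{q,i₀}` and `𝓛_1` agree at primes `s ∤ q`. [cite: FordGreenKonyaginMaynardTao2018, §8] -/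
theorem singFactor_wbpForms (h : Fin k → ℤ) {q s : ℕ} (hs : s.Prime) (hsq : ¬ s ∣ q) (i₀ : Fin k) :
    singFactor (wbpForms h q i₀) s = singFactor (tupleForms h 1) s := by
  simp only [singFactor, omegaL_wbpForms h hs hsq, omegaL_tupleForms h hs (Nat.Prime.not_dvd_one hs)]

/-- **Partial products of `𝔖_D(L̃_{q,i₀})` vs `𝔖_D(𝓛_1)`** differ exactly in the factor at `q`.
[cite: FordGreenKonyaginMaynardTao2018, §8 proof of (6.4)] -/
theorem singPartial_wbpForms_mul (h : Fin k → ℤ) {q : ℕ} (hq : q.Prime) (i₀ : Fin k) {D x : ℕ}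
    (hqD : ¬ q ∣ D) (hqx : q ≤ x) :
    singPartial (wbpForms h q i₀) D x * singFactor (tupleForms h 1) q =
      singPartial (tupleForms h 1) D x * singFactor (wbpForms h q i₀) q :=
  singPartial_mul_singFactor_of_agree hq hqD hqx fun _ hs hsq =>
    singFactor_wbpForms h hs (fun hdvd => hsq ((Nat.prime_dvd_prime_iff_eq hs hq).mp hdvd)) i₀

/-- Away from `q` the partial products of `L̃_{q,i₀}` and `𝓛_1` agree. [cite: FordGreenKonyaginMaynardTao2018, §8] -/
theorem singPartial_wbpForms_of_not_mem (h : Fin k → ℤ) {q : ℕ} (hq : q.Prime) (i₀ : Fin k) {D x : ℕ}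
    (hqDx : q ∣ D ∨ x < q) :
    singPartial (wbpForms h q i₀) D x = singPartial (tupleForms h 1) D x :=
  singPartial_eq_of_agree hqDx fun _ hs hsq =>
    singFactor_wbpForms h hs (fun hdvd => hsq ((Nat.prime_dvd_prime_iff_eq hs hq).mp hdvd)) i₀

/-- `φ_ω` of `L̃_{q,i₀}` agrees with that of `𝓛_1` on integers whose prime factors are `≠ q`.
[cite: FordGreenKonyaginMaynardTao2018, §8 proof of (6.4)] -/
theorem phiOmega_wbpForms (h : Fin k → ℤ) {q : ℕ} (hq : q.Prime) (i₀ : Fin k) {m : ℕ}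
    (hm : ∀ s ∈ m.primeFactors, s ≠ q) :
    phiOmega (wbpForms h q i₀) m = phiOmega (tupleForms h 1) m := by
  unfold phiOmega
  refine Finset.prod_congr rfl fun s hs => ?_
  have hsprime : s.Prime := Nat.prime_of_mem_primeFactors hs
  have hsq : ¬ s ∣ q := fun hdvd => hm s hs ((Nat.prime_dvd_prime_iff_eq hsprime hq).mp hdvd)
  rw [omegaL_wbpForms h hsprime hsq, omegaL_tupleForms h hsprime (Nat.Prime.not_dvd_one hsprime)]

/-- **`𝒟_k(L̃_{q,i₀})` is the `p`-free box** for `q > R` prime and a tuple incongruent modulo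
primes `> 2k²` — hence equal to `𝒟_k(𝓛_p)` (§8: "`𝒟_k(L̃_{q,i}) ∩ {d ≤ R} = 𝒟_k(𝓛_p) ∩ {d ≤ R}`").
[cite: FordGreenKonyaginMaynardTao2018, §8 proof of (6.4)] -/
theorem dkBox_wbpForms (h : Fin k → ℤ) {q : ℕ} (hq : q.Prime) (i₀ : Fin k) {B : ℕ} {R : ℝ}
    (hRq : ⌊R⌋₊ < q)
    (hh : ∀ s : ℕ, s.Prime → 2 * k ^ 2 < s → ∀ i j : Fin k, i ≠ j → ¬ (s : ℤ) ∣ h i - h j) :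
    dkBox (wbpForms h q i₀) B R = dkBoxCoprime k B R := by
  unfold dkBox dkBoxCoprime
  refine Finset.filter_congr fun d hd => ?_
  refine ⟨fun hc => ⟨hc.1, hc.2.1⟩, fun hc => ⟨hc.1, hc.2, fun j s hs => ?_⟩⟩
  have hsprime : s.Prime := Nat.prime_of_mem_primeFactors hs
  have hsd : s ∣ d j := Nat.dvd_of_mem_primeFactors hs
  haveI := Fact.mk hsprime
  have hsprod : s ∣ ∏ i, d i := hsd.trans (Finset.dvd_prod_of_mem _ (Finset.mem_univ j))
  have hsWB : ¬ s ∣ wCut k B * B :=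
    (Nat.Prime.coprime_iff_not_dvd hsprime).mp (Nat.Coprime.coprime_dvd_left hsprod hc.2)
  have hsW : ¬ s ∣ wCut k B := fun h' => hsWB (h'.mul_right B)
  have hsB : ¬ s ∣ B := fun h' => hsWB (h'.mul_left _)
  have h2k : 2 * k ^ 2 < s := lt_of_prime_not_dvd_wCut hsprime hsW hsB
  have hdj : d j ∈ Finset.Icc 1 ⌊R⌋₊ := Fintype.mem_piFinset.mp hd j
  rw [Finset.mem_Icc] at hdj
  have hsR : s ≤ ⌊R⌋₊ := (Nat.le_of_dvd (by omega) hsd).trans hdj.2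
  have hsq : ¬ s ∣ q := fun hdvd => by
    have := (Nat.prime_dvd_prime_iff_eq hsprime hq).mp hdvd
    omega
  have hq0 : (q : ZMod s) ≠ 0 := by
    rwa [Ne, ZMod.natCast_eq_zero_iff]
  have hcast : ∀ i j : Fin k, i ≠ j → ((h i : ℤ) : ZMod s) - ((h j : ℤ) : ZMod s) ≠ 0 := by
    intro i j hij
    rw [← Int.cast_sub, Ne, ZMod.intCast_zmod_eq_zero_iff_dvd]
    exact hh s hsprime h2k i j hij
  rw [leastIndexClause_iff]
  by_cases hji : j = i₀
  · subst hji
    refine ⟨0, by rw [formMod_wbpForms_self], fun j' hj' => ?_⟩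
    rw [formMod_wbpForms_of_ne h q (ne_of_lt hj'), mul_zero, zero_add]
    exact hq0
  · set D : ZMod s := ((h j : ℤ) : ZMod s) - ((h i₀ : ℤ) : ZMod s) with hDdef
    have hD0 : D ≠ 0 := hcast j i₀ hji
    refine ⟨-((q : ZMod s) * D⁻¹), ?_, fun j' hj' => ?_⟩
    · rw [formMod_wbpForms_of_ne h q hji, ← hDdef, mul_neg, mul_comm D, mul_assoc, inv_mul_cancel₀ hD0,
        mul_one, neg_add_cancel]
    · by_cases hj'i : j' = i₀
      · subst hj'i
        rw [formMod_wbpForms_self]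
        exact neg_ne_zero.mpr (mul_ne_zero hq0 (inv_ne_zero hD0))
      · rw [formMod_wbpForms_of_ne h q hj'i]
        set D' : ZMod s := ((h j' : ℤ) : ZMod s) - ((h i₀ : ℤ) : ZMod s) with hD'def
        have hDD' : D - D' ≠ 0 := by
          rw [hDdef, hD'def, sub_sub_sub_cancel_right]
          exact hcast j j' (ne_of_gt hj')
        have : D' * -((q : ZMod s) * D⁻¹) + (q : ZMod s) = (q : ZMod s) * D⁻¹ * (D - D') := by
          have : D * D⁻¹ = 1 := mul_inv_cancel₀ hD0
          linear_combination (-(q : ZMod s)) * this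
        rw [this]
        exact mul_ne_zero (mul_ne_zero hq0 (inv_ne_zero hD0)) hDD'

/-! ### Admissibility of the families via `ω(s) < s` -/

/-- **Admissibility in terms of `ω`**: a family with non-zero leading coefficients is admissible
iff `ω_𝓛(s) < s` for every prime `s`. [cite: Maynard2016DenseClusters, §7 ("since 𝓛 is admissible, ω(p) < p")] -/
theorem formsAdmissible_iff_omegaL (L : Fin k → ℤ × ℤ) :
    FormsAdmissible L ↔ (∀ i, (L i).1 ≠ 0) ∧ ∀ s : ℕ, s.Prime → omegaL L s < s := by
  unfold FormsAdmissible
  refine and_congr Iff.rfl (forall₂_congr fun s hs => ?_)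
  haveI := Fact.mk hs
  rw [omegaL_eq_card_zmod]
  constructor
  · rintro ⟨n, hn⟩
    rw [natCast_dvd_prod_formEval_iff] at hn
    have hlt : #(Finset.univ.filter fun x : ZMod s => ∏ i, formMod (L i) s x = 0) < #(Finset.univ : Finset (ZMod s)) :=
      Finset.card_lt_card (Finset.filter_ssubset.mpr ⟨(n : ZMod s), Finset.mem_univ _, hn⟩)
    simpa only [Finset.card_univ, ZMod.card] using hlt
  · intro hlt
    have hne : (Finset.univ.filter fun x : ZMod s => ∏ i, formMod (L i) s x = 0) ≠ Finset.univ := by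
      intro heq
      rw [heq, Finset.card_univ, ZMod.card] at hlt
      exact lt_irrefl _ hlt
    obtain ⟨x, -, hx⟩ : ∃ x ∈ (Finset.univ : Finset (ZMod s)),
        x ∉ Finset.univ.filter fun x : ZMod s => ∏ i, formMod (L i) s x = 0 := by
      by_contra hall
      push Not at hall
      exact hne (Finset.eq_univ_of_forall fun x => hall x (Finset.mem_univ x))
    refine ⟨(x.val : ℤ), ?_⟩
    rw [natCast_dvd_prod_formEval_iff]
    simpa only [Finset.mem_filter, Finset.mem_univ, true_and, Int.cast_natCast, ZMod.natCast_zmod_val] using hx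

/-- `ω_{𝓛_p}(p) ≤ 1` for `p` prime (all forms reduce to `n`). [cite: FordGreenKonyaginMaynardTao2018, §8] -/
theorem omegaL_tupleForms_self_le (h : Fin k → ℤ) {p : ℕ} (hp : p.Prime) :
    omegaL (tupleForms h p) p ≤ 1 := by
  haveI := Fact.mk hp
  rw [omegaL_eq_card_zmod, ← Finset.card_singleton (0 : ZMod p)]
  refine Finset.card_le_card fun x hx => ?_
  rw [Finset.mem_filter] at hx
  rw [Finset.mem_singleton]
  simp only [formMod_tupleForms, ZMod.natCast_self, mul_zero, add_zero, Finset.prod_const,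
    Finset.card_univ, Fintype.card_fin] at hx
  exact (pow_eq_zero_iff (by rintro rfl; simp at hx)).mp hx.2

/-- **`𝓛_p` is admissible** when the tuple is (`ν_h(s) < s` for all primes `s`) and `p` is `1` or a
prime. [cite: FordGreenKonyaginMaynardTao2018, §8 proof of (6.3)] -/
theorem formsAdmissible_tupleForms (h : Fin k → ℤ) (hadm : ∀ s : ℕ, s.Prime → tupleCount h s < s)
    {p : ℕ} (hp : p = 1 ∨ p.Prime) : FormsAdmissible (tupleForms h p) := by
  rw [formsAdmissible_iff_omegaL]
  refine ⟨fun i => by simp [tupleForms], fun s hs => ?_⟩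
  by_cases hsp : s ∣ p
  · rcases hp with rfl | hp
    · exact absurd (Nat.eq_one_of_dvd_one hsp) hs.ne_one
    · have hse : s = p := (Nat.prime_dvd_prime_iff_eq hs hp).mp hsp
      subst hse
      exact (omegaL_tupleForms_self_le h hs).trans_lt hs.one_lt
  · rw [omegaL_tupleForms h hs hsp]
    exact hadm s hs

/-- Leading coefficients of `L̃_{q,i₀}`. [cite: FordGreenKonyaginMaynardTao2018, §8] -/
theorem wbpForms_fst (h : Fin k → ℤ) (q : ℕ) (i₀ j : Fin k) :
    (wbpForms h q i₀ j).1 = if j = i₀ then 1 else h j - h i₀ := by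
  unfold wbpForms
  split_ifs <;> rfl

/-- Constant coefficients of `L̃_{q,i₀}`. [cite: FordGreenKonyaginMaynardTao2018, §8] -/
theorem wbpForms_snd (h : Fin k → ℤ) (q : ℕ) (i₀ j : Fin k) :
    (wbpForms h q i₀ j).2 = if j = i₀ then 0 else (q : ℤ) := by
  unfold wbpForms
  split_ifs <;> rfl

/-- **`L̃_{q,i₀}` is admissible** for an injective tuple with `ν_h(s) < s` for all primes `s`, `q`
prime and the `h_j` (`j ≠ i₀`) incongruent to `h_{i₀}` mod `q`. [cite: FordGreenKonyaginMaynardTao2018, §8 proof of (6.4)] -/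
theorem formsAdmissible_wbpForms (h : Fin k → ℤ) (hinj : Function.Injective h)
    (hadm : ∀ s : ℕ, s.Prime → tupleCount h s < s) {q : ℕ} (hq : q.Prime) (i₀ : Fin k)
    (hh : ∀ j : Fin k, j ≠ i₀ → ¬ (q : ℤ) ∣ h j - h i₀) : FormsAdmissible (wbpForms h q i₀) := by
  rw [formsAdmissible_iff_omegaL]
  refine ⟨fun j => ?_, fun s hs => ?_⟩
  · rw [wbpForms_fst]
    split_ifs with hj
    · exact one_ne_zero
    · exact sub_ne_zero.mpr (hinj.ne hj)
  · by_cases hsq : s ∣ q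
    · have hse : s = q := (Nat.prime_dvd_prime_iff_eq hs hq).mp hsq
      subst hse
      rw [omegaL_wbpForms_self h hs i₀ hh]
      exact hs.one_lt
    · rw [omegaL_wbpForms h hs hsq]
      exact hadm s hs

/-- The forms of `𝓛_p` evaluated: `L_i(n) = n + h_i p`. [cite: FordGreenKonyaginMaynardTao2018, §8] -/
@[simp] theorem formEval_tupleForms (h : Fin k → ℤ) (p : ℕ) (i : Fin k) (n : ℤ) :
    formEval (tupleForms h p i) n = n + h i * p := by
  simp [formEval, tupleForms]

/-- For the increasing enumeration of an admissible `H`, `ν_h(s) < s` for all primes `s`.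
[cite: FordGreenKonyaginMaynardTao2018, §6] -/
theorem tupleCount_lt_of_isAdmissibleTuple {H : Finset ℤ} (hH : IsAdmissibleTuple H) {k : ℕ}
    (hk : H.card = k) {s : ℕ} (hs : s.Prime) :
    tupleCount (fun i => H.orderEmbOfFin hk i) s < s := by
  rw [tupleCount_orderEmbOfFin H hk]
  exact hH s hs

end Literature.NumberTheory.Sieve.FGKMT2018
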